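import Mathlib
import Literature.NumberTheory.LFunctions.Zhang2022.RepairBedLenxClosedForms
import Literature.NumberTheory.LFunctions.Zhang2022.RepairBedE108Floors
import HarnessLib

/-!
# Zhang (2022), rescue bed (D-0124 (3)/(4)): SATISFIABILITY WITNESSES for the conditional kernel certificates of the
# typ-2 bed files (`RepairBedCoherence` p522810, `RepairBedLenxModel` p524359, `RepairBedLenxClosedForms` p525485,
# `RepairBedE108Floors` p519844/rev 2) — director-frontier g8 rule 2026-08-27T11:10:43Z («every (H₁ ∧ … ∧ Hₙ → C)
# certificate carries one object meeting all Hᵢ at once, else UNWITNESSED»)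

Topic `Literature/NumberTheory/LFunctions/Zhang2022` (Landau–Siegel audit tree; verdict-neutral).
Y. Zhang, *Discrete mean estimates and the Landau–Siegel zero*, arXiv:2211.02515v1 (2022) [Zhang2022LandauSiegel] —
**an unrefereed manuscript under adjudication; nothing here asserts or denies any of its claims, and nothing here is
a claim about Landau–Siegel zeros.**

Each theorem below APPLIES one conditional certificate to an explicit object and discharges ALL its hypotheses at
once (type (a) witness); none of the certificates has two binders that no single object can meet. The one hypothesis
that is DATA rather than arithmetic — the sign fence `∀ ρ ∈ Z, 0 ≤ Re 𝔠*(ρ,ψ)·Re ω(ρ)` of `norm_gramSum_sq_le` /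
`norm_gramSum_le_sqrt_mul` / `norm_gramCoh_le_one` — is witnessed here only by `Z = ∅` (`fence_witness_empty`); its
non-degenerate witnesses are the bed's `w > 0` sub-blocks `M⁺` (spec bed3-addons LENX «companion»), i.e. bed rows, and
the unconditional abs-weight twins (`norm_gramAbsSum_sq_le`, `norm_gramAbsCoh_le_one`) need no fence. Theorems only.

## References

* Y. Zhang, arXiv:2211.02515v1 (2022), §2 (2.16), (2.23); §7 Prop 7.1, (7.2) p.44. [cite: Zhang2022LandauSiegel, §§2, 7]
-/

noncomputable section

open Complex Real ComplexConjugate Set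

namespace Literature.NumberTheory.LFunctions.Zhang2022.Repair.Bed

open KnifeEdge

/-! ### A concrete scale and block data -/

/-- A toy scale with `P = 100` (the bed's S1) for instantiating scale hypotheses `1 < S.P`, `S.P ≤ M`.
[cite: Zhang2022LandauSiegel, §2 (2.1)–(2.30)] -/
def witnessScale : Scale where
  L := 1
  P := 100
  t0 := 1
  L1 := 1
  L2 := 1
  P1 := 10
  P2 := 10
  P3 := 10
  aT := 2

/-- `1 < P` at the witness scale. [cite: Zhang2022LandauSiegel, §2 (2.6)] -/
theorem witnessScale_P : 1 < witnessScale.P := by norm_num [witnessScale]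

/-! ### `RepairBedCoherence` (p522810) -/

/-- Witness for `norm_sum_weight_mul_conj_sq_le` (nonnegative weights): two unit weights.
[cite: Zhang2022LandauSiegel, §2 (2.16)] -/
theorem norm_sum_weight_mul_conj_sq_le_witness :
    ‖∑ _i ∈ (Finset.univ : Finset (Fin 2)), (((1 : ℝ) : ℝ) : ℂ) * ((1 : ℂ) * conj I)‖ ^ 2
      ≤ (∑ _i ∈ (Finset.univ : Finset (Fin 2)), (1 : ℝ) * ‖(1 : ℂ)‖ ^ 2)
        * (∑ _i ∈ (Finset.univ : Finset (Fin 2)), (1 : ℝ) * ‖I‖ ^ 2) :=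
  norm_sum_weight_mul_conj_sq_le Finset.univ (fun _ => 1) (fun _ => 1) (fun _ => I) fun _ _ => zero_le_one

/-- Witness (degenerate) for the SIGN FENCE of `norm_gramSum_sq_le` / `norm_gramSum_le_sqrt_mul` /
`norm_gramCoh_le_one`: the empty zero set meets it at every scale, character and shift; the non-degenerate witnesses
are the bed's `w > 0` sub-blocks (data). [cite: Zhang2022LandauSiegel, §2 (2.16)] -/
theorem fence_witness_empty (S : Scale) {p : ℕ} [NeZero p] (ψ : DirichletCharacter ℂ p) (c' : ℝ) (A B : ℂ → ℂ) :
    ‖gramCoh S ψ c' A B ∅‖ ≤ 1 :=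
  norm_gramCoh_le_one c' A B ∅ fun _ h => absurd h (Finset.notMem_empty _)

/-- Witness for `norm_coh_le_one_of_sq_le` (`‖m‖² ≤ d₁d₂`): `m = 1`, `d₁ = d₂ = 1`.
[cite: Zhang2022LandauSiegel, §2 (2.16)] -/
theorem norm_coh_le_one_witness : ‖coh 1 1 1‖ ≤ 1 := norm_coh_le_one_of_sq_le (by norm_num)

/-- Witness for `norm_coh_lt_one_iff` / `one_lt_norm_coh_iff` (`0 < d₁`, `0 < d₂`): `d₁ = d₂ = 1`.
[cite: Zhang2022LandauSiegel, §2 (2.16)] -/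
theorem norm_coh_iff_witness (m : ℂ) :
    (‖coh m 1 1‖ < 1 ↔ ‖m‖ ^ 2 < 1 * 1) ∧ (1 < ‖coh m 1 1‖ ↔ 1 * 1 < ‖m‖ ^ 2) :=
  ⟨norm_coh_lt_one_iff one_pos one_pos, one_lt_norm_coh_iff one_pos one_pos⟩

/-- Witness for `coh_smul` / `norm_coh_smul` / `gramCoh_smul` / `norm_gramCoh_smul` (`a ≠ 0`, `b ≠ 0`): `a = b = 1`.
[cite: Zhang2022LandauSiegel, §2 (2.16)] -/
theorem coh_smul_witness (m : ℂ) (d₁ d₂ : ℝ) (S : Scale) {p : ℕ} [NeZero p] (ψ : DirichletCharacter ℂ p) (c' : ℝ)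
    (A B : ℂ → ℂ) (Z : Finset ℂ) :
    ‖coh (1 * conj 1 * m) (‖(1:ℂ)‖ ^ 2 * d₁) (‖(1:ℂ)‖ ^ 2 * d₂)‖ = ‖coh m d₁ d₂‖ ∧
      ‖gramCoh S ψ c' (fun ρ => 1 * A ρ) (fun ρ => 1 * B ρ) Z‖ = ‖gramCoh S ψ c' A B Z‖ :=
  ⟨norm_coh_smul one_ne_zero one_ne_zero m d₁ d₂, norm_gramCoh_smul c' one_ne_zero one_ne_zero A B Z⟩

/-- Witness for `blockQuad_pos` (`0 < d₁`, `‖m‖² < d₁d₂`, `(x,y) ≠ 0`): the identity block at `(1,0)`.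
[cite: Zhang2022LandauSiegel, §7 (7.2) p.44] -/
theorem blockQuad_pos_witness : 0 < blockQuad 1 1 0 1 0 :=
  blockQuad_pos one_pos (by norm_num) 1 0 (Or.inl one_ne_zero)

/-- Witness for `exists_blockQuad_neg` (`0 < d₁`, `d₁d₂ < ‖m‖²`): `d₁ = 1`, `d₂ = 0`, `m = 1`.
[cite: Zhang2022LandauSiegel, §7 (7.2) p.44] -/
theorem exists_blockQuad_neg_witness : blockQuad 1 0 1 (-1 / 1) 1 < 0 :=
  exists_blockQuad_neg one_pos (by norm_num)

/-- Witness for `blockQuad_corner_zero_indefinite` / `modelBlock_det_neg` (`m ≠ 0`): `m = 1`, `d₂ = b = 0`.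
[cite: Zhang2022LandauSiegel, §7 (7.2) p.44] -/
theorem corner_zero_witness :
    blockQuad 0 0 1 ((((1 - 0) / (2 * ‖(1:ℂ)‖ ^ 2) : ℝ) : ℂ) * 1) 1 = 1 ∧
      (Matrix.det !![(0 : ℂ), 1; conj 1, ((0:ℝ) : ℂ)]).re < 0 :=
  ⟨(blockQuad_corner_zero_indefinite one_ne_zero 0).1, modelBlock_det_neg one_ne_zero 0⟩

/-- Witness for `blockQuad_nonneg_iff` (`0 ≤ d₁`, `0 ≤ d₂`): the zero block (`m = 0`) is PSD.
[cite: Zhang2022LandauSiegel, §7 (7.2) p.44] -/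
theorem blockQuad_nonneg_iff_witness : ∀ x y, 0 ≤ blockQuad 0 0 0 x y :=
  (blockQuad_nonneg_iff le_rfl le_rfl).2 (by norm_num)

/-! ### `RepairBedLenxModel` (p524359) and `RepairBedLenxClosedForms` (p525485) -/

/-- Witness for `archProfile_eq_phiT` (`1 ≤ x`) and `profCoefS_archProfile_eq` (`1 < S.P`, `S.P ≤ n`): `x = 1`,
the witness scale and `n = 100`. [cite: Zhang2022LandauSiegel, §2 (2.23); §7 (7.2) p.44] -/
theorem archProfile_witness (θ : ℝ) :
    archProfile θ 1 = phiT θ 1 ∧ profCoefS witnessScale (archProfile θ) 100 = profCoefS witnessScale (phiT θ) 100 :=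
  ⟨archProfile_eq_phiT le_rfl, profCoefS_archProfile_eq witnessScale witnessScale_P (by norm_num [witnessScale])⟩

/-- Witness for `profBlockB_archProfile_eq_phiT` (`1 < S.P`, `S.P ≤ M`): the witness scale, `M = 100`, any block end,
character and point. [cite: Zhang2022LandauSiegel, §2 (2.23), (2.30)] -/
theorem profBlockB_archProfile_witness (θ : ℝ) {D : ℕ} (χ : DirichletCharacter ℂ D) {p : ℕ}
    (ψ : DirichletCharacter ℂ p) (N : ℕ) (s : ℂ) :
    profBlockB witnessScale χ ψ (archProfile θ) 100 N s = profBlockB witnessScale χ ψ (phiT θ) 100 N s :=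
  profBlockB_archProfile_eq_phiT witnessScale witnessScale_P χ ψ (by norm_num [witnessScale]) N s

/-- Witness for every `1 ≤ θ` / `1 < θ` certificate of the model side (masses, cross values, rank-one coupling on
the jump, closed forms, positivity): `θ = 2` (`h = 1`). [cite: Zhang2022LandauSiegel, §7 (7.2) p.44; §8 (8.11)–(8.12)] -/
theorem lenxModel_witness_two :
    overhangMass 2 (archProfile 2) = ((phiInt 2 : ℝ) : ℂ) ∧
    overhangMass 2 (jumpProfile 2) = ((((2 - 1) ^ 2 / 2 : ℝ)) : ℂ) ∧
    (π : ℂ) * conj (overhangMass 2 (archProfile 2)) * tailFunctional gStar = ((4 * π * (2 - 1) ^ 3 : ℝ) : ℂ) ∧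
    (π : ℂ) * conj (overhangMass 2 (jumpProfile 2)) * tailFunctional gStar = ((12 * π * (2 - 1) ^ 2 : ℝ) : ℂ) ∧
    MformTop 2 gStar gStar' (jumpProfile 2) (jumpProfile' 2) = ((12 * π * (2 - 1) ^ 2 : ℝ) : ℂ) ∧
    (topDiagForm 2 (phiT 2) (phiT' 2)).re = 8 * (2 - 1) ^ 3 / (3 * π) + 44 / 15 * π * (2 - 1) ^ 5 ∧
    (topDiagForm 2 (jumpProfile 2) (jumpProfile' 2)).re = 8 * (2 - 1) / π + 52 / 3 * π * (2 - 1) ^ 3 ∧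
    (0 < (topDiagForm 2 (phiT 2) (phiT' 2)).re ∧ 0 < (topDiagForm 2 (jumpProfile 2) (jumpProfile' 2)).re) :=
  ⟨overhangMass_archProfile one_le_two, overhangMass_jumpProfile one_le_two,
    crossModel_gStar_archProfile one_le_two, crossModel_gStar_jumpProfile one_le_two,
    (MformTop_gStar_jumpProfile one_le_two).1, topDiagForm_phiT_re one_le_two,
    topDiagForm_jumpProfile_re one_le_two, topDiagForm_re_pos_arch_jump one_lt_two⟩

/-- Witness for `MformTop_inClass_jumpProfile` (`1 ≤ θ`, `InClassPiece u u'`): `θ = 2`, `u = g⋆`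
(`KnifeEdge.inClassPiece_gStar`). [cite: Zhang2022LandauSiegel, §7 (7.2) p.44; §8 (8.11)–(8.12)] -/
theorem MformTop_inClass_jumpProfile_witness :
    MformTop 2 gStar gStar' (jumpProfile 2) (jumpProfile' 2) = ((((2 - 1) ^ 2 / 2 * π : ℝ)) : ℂ) * tailFunctional gStar :=
  (MformTop_inClass_jumpProfile one_le_two inClassPiece_gStar).1

/-- Witness for `blockQuad_nonneg_iff_threshold` (`0 ≤ μ`, `0 < b`) and `exists_blockQuad_neg_of_lt_threshold`
(`0 ≤ μ`, `0 < b`, `μ < uKThreshold c b`): `μ = 0`, `b = 1`, `c = 1` (`uKThreshold 1 1 = 1 > 0`).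
[cite: Zhang2022LandauSiegel, §7 (7.2) p.44] -/
theorem uKThreshold_witness :
    ((∀ x y, 0 ≤ blockQuad 0 1 1 x y) ↔ uKThreshold 1 1 ≤ 0) ∧ ∃ x y, blockQuad 0 1 1 x y < 0 :=
  ⟨blockQuad_nonneg_iff_threshold le_rfl one_pos,
    exists_blockQuad_neg_of_lt_threshold le_rfl one_pos (by norm_num [uKThreshold])⟩

/-! ### `RepairBedE108Floors` (p519844, rev 2) -/

/-- Witness for the E108 certificates (`0 ≤ w i`, `UnitModulus u`, `0 < W`, `0 < ‖a‖²`): one zero of weight `1`,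
a one-element band, the all-ones vector. [cite: Zhang2022LandauSiegel, §2 (2.16); §7 (7.2) p.44] -/
theorem e108_witness :
    E108.Q (fun _ : Fin 1 => (1:ℝ)) (fun (_ : Fin 1) (_ : Fin 1) => (1:ℂ)) (fun _ : Fin 1 => (1:ℂ))
        ≤ E108.W (fun _ : Fin 1 => (1:ℝ)) * (Fintype.card (Fin 1) : ℝ) * E108.nsq (fun _ : Fin 1 => (1:ℂ)) ∧
      (1:ℝ) * (Fintype.card (Fin 1) : ℝ) ^ 2 ≤ E108.Q (fun _ : Fin 1 => (1:ℝ)) (fun (_ : Fin 1) (_ : Fin 1) => (1:ℂ)) (fun _ : Fin 1 => (1:ℂ)) ∧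
      E108.Q (fun _ : Fin 1 => (1:ℝ)) (fun (_ : Fin 1) (_ : Fin 1) => (1:ℂ)) (fun _ : Fin 1 => (1:ℂ))
          / (E108.W (fun _ : Fin 1 => (1:ℝ)) * E108.nsq (fun _ : Fin 1 => (1:ℂ))) ≤ (Fintype.card (Fin 1) : ℝ) := by
  have hw : ∀ _i : Fin 1, (0:ℝ) ≤ 1 := fun _ => zero_le_one
  have hu : E108.UnitModulus (fun (_ : Fin 1) (_ : Fin 1) => (1:ℂ)) := fun _ _ => by simp
  have hW : 0 < E108.W (fun _ : Fin 1 => (1:ℝ)) := by simp [E108.W]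
  have ha : 0 < E108.nsq (fun _ : Fin 1 => (1:ℂ)) := by simp [E108.nsq]
  exact ⟨E108.Q_le_card_mul_nsq hw hu _, E108.rankOne_floor hw hu 0, E108.rayleigh_le_card hw hW hu ha⟩


/-! ## Rev 2 — the remaining certificates of the four files (exact census: every theorem with a non-typeclass
hypothesis is applied once to an explicit object) -/

/-- Witness for the remaining `1 ≤ θ` / `1 ≤ y ≤ θ` certificates of `RepairBedLenxModel` / `RepairBedLenxClosedForms`
(`MformTop_gStar_phiT_eq`, `tail_jumpProfile`, `tail_phiT`, the per-`j` summands at `j = 1`, `MformTop_jumpProfile`,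
`MformTop_phiT`, `uKThreshold_arch_closed`, `uKThreshold_jump_closed`): `θ = 2`, `y = 1`.
[cite: Zhang2022LandauSiegel, §7 (7.2) p.44; §8 (8.11)–(8.12)] -/
theorem lenxClosedForms_witness_two :
    MformTop 2 gStar gStar' (phiT 2) (phiT' 2) = ((4 * π * (2 - 1) ^ 3 : ℝ) : ℂ) ∧
    (∫ t in (1:ℝ)..2, jumpProfile 2 t) = ((((2 - 1) ^ 2 / 2 : ℝ)) : ℂ) ∧
    (∫ t in (1:ℝ)..2, phiT 2 t) = ((((2 - 1) ^ 3 / 6 - (2 - 1) * (1 - 1) ^ 2 / 2 + (1 - 1) ^ 3 / 3 : ℝ)) : ℂ) ∧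
    (∫ y in (0:ℝ)..2, dipoleIntegrandTop 2 1 (jumpProfile 2) (jumpProfile' 2) (jumpProfile 2) (jumpProfile' 2) y
      = ((2 - 1 : ℝ) : ℂ) + I * ((π * (bS 1 - (1:ℕ)) * ((2 - 1) ^ 2 / 2) : ℝ) : ℂ)
        + ((π ^ 2 * ((1:ℕ) * bS 1 - bN 1 / 2) * ((2 - 1) ^ 3 / 3) : ℝ) : ℂ)
        + I * ((π ^ 3 * (1:ℕ) * bN 1 * ((2 - 1) ^ 4 / 8) : ℝ) : ℂ)) ∧
    (∫ y in (0:ℝ)..2, dipoleIntegrandTop 2 1 (phiT 2) (phiT' 2) (phiT 2) (phiT' 2) y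
      = (((2 - 1) ^ 3 / 3 : ℝ) : ℂ) + ((π ^ 2 * (bN 1 + (1:ℕ) * bS 1) * ((2 - 1) ^ 5 / 30) : ℝ) : ℂ)
        + I * ((π ^ 3 * (1:ℕ) * bN 1 * ((2 - 1) ^ 6 / 72) : ℝ) : ℂ)) ∧
    MformTop 2 (jumpProfile 2) (jumpProfile' 2) (jumpProfile 2) (jumpProfile' 2)
      = ((4 * (2 - 1) / π + 26 * π * (2 - 1) ^ 3 / 3 : ℝ) : ℂ) + I * ((3 * (2 - 1) ^ 2 + 3 * π ^ 2 * (2 - 1) ^ 4 : ℝ) : ℂ) ∧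
    MformTop 2 (phiT 2) (phiT' 2) (phiT 2) (phiT' 2)
      = ((4 * (2 - 1) ^ 3 / (3 * π) + 22 / 15 * π * (2 - 1) ^ 5 : ℝ) : ℂ) + I * ((π ^ 2 * (2 - 1) ^ 6 / 3 : ℝ) : ℂ) ∧
    uKThreshold (((4 * π * (2 - 1) ^ 3 : ℝ)) : ℂ) (topDiagForm 2 (phiT 2) (phiT' 2)).re
      = 16 * π ^ 2 * (2 - 1) ^ 6 / (8 * (2 - 1) ^ 3 / (3 * π) + 44 / 15 * π * (2 - 1) ^ 5) ∧
    uKThreshold (((12 * π * (2 - 1) ^ 2 : ℝ)) : ℂ) (topDiagForm 2 (jumpProfile 2) (jumpProfile' 2)).re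
      = 144 * π ^ 2 * (2 - 1) ^ 4 / (8 * (2 - 1) / π + 52 / 3 * π * (2 - 1) ^ 3) :=
  ⟨MformTop_gStar_phiT_eq one_le_two, tail_jumpProfile le_rfl one_le_two, tail_phiT le_rfl one_le_two,
    integral_dipoleIntegrandTop_jumpProfile one_le_two 1, integral_dipoleIntegrandTop_phiT one_le_two 1,
    MformTop_jumpProfile one_le_two, MformTop_phiT one_le_two, uKThreshold_arch_closed one_le_two,
    uKThreshold_jump_closed one_le_two⟩

/-- Witness for the remaining E108 certificates (`rankOne_floor_rayleigh`, `inner_self_eq_card`, `nsq_eq_card`,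
`Q_single`, `trace_eq`, `exists_rayleigh_ge_rank_floor`, `sum_sq_le_max_mul` with `w ≤ w_max = 1`): the same one-zero,
one-element-band, unit data. [cite: Zhang2022LandauSiegel, §2 (2.16); §7 (7.2) p.44] -/
theorem e108_witness' :
    (1:ℝ) * (Fintype.card (Fin 1) : ℝ) * E108.nsq ((fun (_ : Fin 1) (_ : Fin 1) => (1:ℂ)) 0)
        ≤ E108.Q (fun _ : Fin 1 => (1:ℝ)) (fun (_ : Fin 1) (_ : Fin 1) => (1:ℂ)) ((fun (_ : Fin 1) (_ : Fin 1) => (1:ℂ)) 0) ∧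
    (∑ n, conj ((fun (_ : Fin 1) (_ : Fin 1) => (1:ℂ)) 0 n) * (fun (_ : Fin 1) (_ : Fin 1) => (1:ℂ)) 0 n)
        = (Fintype.card (Fin 1) : ℂ) ∧
    E108.nsq ((fun (_ : Fin 1) (_ : Fin 1) => (1:ℂ)) 0) = (Fintype.card (Fin 1) : ℝ) ∧
    E108.Q (fun _ : Fin 1 => (1:ℝ)) (fun (_ : Fin 1) (_ : Fin 1) => (1:ℂ)) (Pi.single (0 : Fin 1) (1:ℂ))
        = E108.W (fun _ : Fin 1 => (1:ℝ)) ∧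
    (∑ n, E108.K (fun _ : Fin 1 => (1:ℝ)) (fun (_ : Fin 1) (_ : Fin 1) => (1:ℂ)) n n)
        = (E108.W (fun _ : Fin 1 => (1:ℝ)) : ℂ) * (Fintype.card (Fin 1) : ℂ) ∧
    (∃ j, E108.W (fun _ : Fin 1 => (1:ℝ)) / (Fintype.card (Fin 1) : ℝ) * (Fintype.card (Fin 1) : ℝ)
        * E108.nsq ((fun (_ : Fin 1) (_ : Fin 1) => (1:ℂ)) j)
        ≤ E108.Q (fun _ : Fin 1 => (1:ℝ)) (fun (_ : Fin 1) (_ : Fin 1) => (1:ℂ)) ((fun (_ : Fin 1) (_ : Fin 1) => (1:ℂ)) j)) ∧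
    (∑ i, (fun _ : Fin 1 => (1:ℝ)) i ^ 2) ≤ 1 * E108.W (fun _ : Fin 1 => (1:ℝ)) := by
  have hw : ∀ _i : Fin 1, (0:ℝ) ≤ 1 := fun _ => zero_le_one
  have hu : E108.UnitModulus (fun (_ : Fin 1) (_ : Fin 1) => (1:ℂ)) := fun _ _ => by simp
  have hmax : ∀ _i : Fin 1, (1:ℝ) ≤ 1 := fun _ => le_rfl
  exact ⟨E108.rankOne_floor_rayleigh hw hu 0, E108.inner_self_eq_card hu 0, E108.nsq_eq_card hu 0,
    E108.Q_single hu 0, E108.trace_eq hu, E108.exists_rayleigh_ge_rank_floor hw hu, E108.sum_sq_le_max_mul hw hmax⟩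

end Literature.NumberTheory.LFunctions.Zhang2022.Repair.Bed
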